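import Literature.Computability.Complexity.StockmeyerMachines

/-!
# PneNP / PhaseTwins — `NoFBPPApproxAboveUniqueness` (stmt-PneNP-2717), stub S0: the concrete Stockmeyer counter's guarantee

Route `PneNP/PhaseTwins`, support item stmt-PneNP-2717 (`NoFBPPApproxAboveUniqueness`), line
`SketchIdeator1`, stub S0 (`stub_counter_spec`). The tree's
`StockMachine.stockmeyerApproxCounting_holds` (`Literature/Computability/Complexity/StockmeyerMachines.lean`)
hides Stockmeyer's approximate counter behind an existential `∃ L F c`; the line needs the SAME
guarantee for the concrete objects `StockMachine.counter R` (the truth-table transducer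
`ttFn qryF qPoly outG (threshLang R)`) and the coin budget `StockMachine.coinPoly = 24 n³ + n² + n`,
with no hypothesis on the relation `R` (in the tree `R ∈ P^O` serves only to place `threshLang R` in
`NP^O`, not for the estimate):

* `stub_counter_spec`: for all `x`, `m` and `kη, kδ ≥ 1`, the answer of `counter R` on
  `⟨x, 1^m, 1^{kη}, 1^{kδ}, u⟩`, read as a number, approximates `#{y ∈ {0,1}^m | ⟨x, y⟩ ∈ R}` within
  the factor `1 + 1/kη` for all but a `1/kδ` fraction of the coin strings
  `u ∈ {0,1}^{coinPoly (|x|+m+kη+kδ)}`.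

Proof (the body of `stockmeyerApproxCounting_holds`, minus the oracle bookkeeping):
`countEstimate_counter` identifies the answer with `Stockmeyer.estimate m T (levelCount R m x u)`,
`T = |countQuery x m kη kδ u| + 1`, which depends on `u` only through `|u|` (`length_countQuery_eq`),
so `uniformProb_congr` rewrites the event on the strings of the sampled length; then
`Stockmeyer.uniformProb_not_isApproxCount_le` applies, since `T > |u| = 24 n³ + n² + n ≥ 24 kη² kδ`
(`coinPoly_eval`, `length_le_length_countQuery`) and `|u| ≥ n (n + 1) ≥ m (m + 1)`.

References: S. Aaronson, A. Arkhipov, *The computational complexity of linear optics*, Theory of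
Computing 9 (2013) 143–252, Thm. 4.1 (p. 175); after L. J. Stockmeyer, *On approximation
algorithms for #P*, SIAM J. Comput. 14 (1985) 849–861, Thm. 3.1.
-/

-- `Summit.PneNP.PneNP.…` duplicates `PneNP` BY DESIGN (single-problem summit layout).
set_option linter.dupNamespace false

namespace Summit.PneNP.PneNP.Theorems.NoFBPPApproxAboveUniqueness

open Literature.Computability.Complexity _root_.Computability Polynomial StockMachine Stockmeyer Finset

/-- **Stub S0 — the concrete Stockmeyer counter is probably approximately correct.** For every
relation `R`, instance `x`, witness length `m` and `kη, kδ ≥ 1`, the answer of the truth-table counter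
`StockMachine.counter R` on `⟨x, 1^m, 1^{kη}, 1^{kδ}, u⟩`, read as a number, approximates
`#{y ∈ {0,1}^m | ⟨x, y⟩ ∈ R}` to within the factor `1 + 1/kη` for all but a `1/kδ` fraction of the
coin strings `u ∈ {0,1}^{coinPoly (|x|+m+kη+kδ)}` (the body of
`StockMachine.stockmeyerApproxCounting_holds`, stated for the concrete counter and coin budget).
[cite: AaronsonArkhipovToC2013, Thm. 4.1 (p. 175)] -/
theorem stub_counter_spec (R : Language Bool) (x : List Bool) (m kη kδ : ℕ) (hkη : 0 < kη) (hkδ : 0 < kδ) :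
    uniformProb (coinPoly.eval (x.length + m + kη + kδ))
      {u | ¬ IsApproxCount kη (countWitnesses R m x) (countEstimate (counter R) x m kη kδ u)} ≤ 1 / (kδ : ℝ) := by
  -- adapted from `StockMachine.stockmeyerApproxCounting_holds` (StockmeyerMachines.lean)
  set n := x.length + m + kη + kδ with hn
  set ℓ := coinPoly.eval n with hℓ
  set T := (countQuery x m kη kδ (List.replicate ℓ false)).length + 1 with hT
  have hTu : ∀ u : List Bool, u.length = ℓ → (countQuery x m kη kδ u).length + 1 = T := fun u hu => by
    rw [hT, length_countQuery_eq x m kη kδ (u' := List.replicate ℓ false) (by simp [hu])]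
  have hev : ∀ u : List Bool, u.length = ℓ →
      (u ∈ {u | ¬ IsApproxCount kη (countWitnesses R m x) (countEstimate (counter R) x m kη kδ u)} ↔
        u ∈ {u | ¬ IsApproxCount kη (countWitnesses R m x) (estimate m T (levelCount R m x u))}) :=
    fun u hu => by simp only [Set.mem_setOf_eq, countEstimate_counter, hTu u hu]
  rw [StockMachine.uniformProb_congr hev]
  have hℓeq : ℓ = 24 * n ^ 3 + n ^ 2 + n := by rw [hℓ, StockMachine.coinPoly_eval]
  have hkηn : kη ≤ n := by omega
  have hkδn : kδ ≤ n := by omega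
  have hmn : m ≤ n := by omega
  refine uniformProb_not_isApproxCount_le R x hkη hkδ ?_ ?_
  · have h1 : ℓ ≤ (countQuery x m kη kδ (List.replicate ℓ false)).length := by
      simpa using length_le_length_countQuery x m kη kδ (List.replicate ℓ false)
    have h2 : kη ^ 2 * kδ ≤ n ^ 3 := by
      calc kη ^ 2 * kδ ≤ n ^ 2 * n := Nat.mul_le_mul (Nat.pow_le_pow_left hkηn 2) hkδn
        _ = n ^ 3 := by ring
    calc 24 * kη ^ 2 * kδ = 24 * (kη ^ 2 * kδ) := by ring
      _ ≤ 24 * n ^ 3 := Nat.mul_le_mul_left 24 h2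
      _ ≤ ℓ := by omega
      _ ≤ T := by omega
  · calc m * (m + 1) ≤ n * (n + 1) := Nat.mul_le_mul hmn (by omega)
      _ = n ^ 2 + n := by ring
      _ ≤ ℓ := by omega

end Summit.PneNP.PneNP.Theorems.NoFBPPApproxAboveUniqueness
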